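import Mathlib.Analysis.ODE.Gronwall
import Mathlib.Analysis.SpecialFunctions.Sqrt
import Mathlib.Analysis.Calculus.ContDiff.Deriv
import Literature.Analysis.ODE.LinearComparison
import Literature.Analysis.ODE.MaximalTime
import HarnessLib

/-!
# One-sided scalar comparison toolkit (Gronwall, fencing, mean value) for `C¹` functions on a half-line

Elementary real-analysis lemmas used throughout the formalisation of §6.4–6.7 of
T. Tao, *Finite time blowup for an averaged three-dimensional Navier–Stokes equation*,
J. Amer. Math. Soc. 29 (2016), 601–674 (arXiv:1402.0290v3), where every step is an explicit
"Gronwall's inequality" / "continuity argument" / "fundamental theorem of calculus" for scalar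
functions that are continuously differentiable on a half-line `[T₀, +∞)`.

The regularity class is the one of Mathlib's fencing theorems
(`image_le_of_deriv_right_lt_deriv_boundary'` etc.): `f` continuous on `[a, b]` with a right
derivative `f' x` within `Ici x` at every `x ∈ [a, b)`. Everything here is folklore.

## Contents

* `hasDerivWithinAt_Ico_of_contDiffOn`: a `C¹` function on `Ici T₀` is in the class on every
  `[a, b] ⊆ Ici T₀`, with `f' = derivWithin f (Ici T₀)` (the pointwise glue is
  `hasDerivWithinAt_Ici_of_contDiffOn` of `LinearComparison.lean`).
* `gronwallBound_le_mul_exp`: `gronwallBound δ K ε x ≤ (δ + ε x) e^{K x}` for `ε, K ≥ 0`.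
* `abs_le_of_abs_deriv_right_le_affine`: `|f'| ≤ α + β |f|` ⟹ `|f x| ≤ (|f a| + α (x-a)) e^{β (x-a)}`.
* `le_gronwallBound_of_deriv_right_le`, `gronwallBound_neg_le_of_le_deriv_right`: signed linear
  comparison `f' ≤ β f + α` (resp. `β f - α ≤ f'`).
* `sub_le_mul_of_deriv_right_le`, `mul_le_sub_of_le_deriv_right`, `le_of_deriv_right_nonneg`:
  one-sided mean value inequalities.
* `exp_mul_le_of_le_deriv_right`, `le_mul_exp_of_deriv_right_le`: exponential barriers
  `f a e^{β (x-a)} ≤ f x` from `β f ≤ f'`, resp. `f x ≤ f a e^{β (x-a)}` from `f' ≤ β f`.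
* `hasDerivWithinAt_sqrt_add_const`: derivative of `√(Z + κ)`, `κ > 0`, `Z ≥ 0`.
* `maximalTimeP_le_const_spec`, `eq_of_maximalTimeP_le_const_lt`, …: the maximal time of
  `MaximalTime.lean` for the closed condition `g t ≤ C`, `g` continuous ("first exit time").
-/

noncomputable section

open Set Real Filter Topology

namespace Literature.Analysis.ODE

/-! ## From `C¹` on a half-line to one-sided derivatives

(`hasDerivWithinAt_Ici_of_contDiffOn`, `continuousOn_Icc_of_contDiffOn` are in
`Literature/Analysis/ODE/LinearComparison.lean`.) -/

/-- The one-sided derivative data on `[a, b)` of a `C¹` function on `[T₀, ∞)`, `T₀ ≤ a`, in the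
form consumed by Mathlib's fencing theorems. [folklore] -/
theorem hasDerivWithinAt_Ico_of_contDiffOn {f : ℝ → ℝ} {T₀ a b : ℝ}
    (hf : ContDiffOn ℝ 1 f (Ici T₀)) (ha : T₀ ≤ a) :
    ∀ x ∈ Ico a b, HasDerivWithinAt f (derivWithin f (Ici T₀) x) (Ici x) x :=
  fun _ hx => hasDerivWithinAt_Ici_of_contDiffOn hf (ha.trans hx.1)

/-! ## Gronwall-type bounds -/

/-- `e^y - 1 ≤ y e^y` (all real `y`). [folklore] -/
theorem exp_sub_one_le_mul_exp (y : ℝ) : exp y - 1 ≤ y * exp y := by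
  have h := add_one_le_exp (-y)
  have hpos := exp_pos y
  have : exp (-y) * exp y = 1 := by rw [← exp_add]; simp
  nlinarith [mul_le_mul_of_nonneg_right h hpos.le]

/-- For `ε, K ≥ 0`, `gronwallBound δ K ε x ≤ (δ + ε x) e^{K x}`. [folklore] -/
theorem gronwallBound_le_mul_exp {δ K ε x : ℝ} (hε : 0 ≤ ε) (hK : 0 ≤ K) :
    gronwallBound δ K ε x ≤ (δ + ε * x) * exp (K * x) := by
  rcases eq_or_lt_of_le hK with rfl | hKpos
  · simp [gronwallBound_K0]
  · rw [gronwallBound_of_K_ne_0 hKpos.ne']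
    have h1 : exp (K * x) - 1 ≤ K * x * exp (K * x) := exp_sub_one_le_mul_exp _
    have h2 : ε / K * (exp (K * x) - 1) ≤ ε * x * exp (K * x) := by
      calc ε / K * (exp (K * x) - 1) ≤ ε / K * (K * x * exp (K * x)) := by
            apply mul_le_mul_of_nonneg_left h1 (by positivity)
        _ = ε * x * exp (K * x) := by field_simp
    nlinarith [exp_pos (K * x)]

variable {f f' : ℝ → ℝ} {a b : ℝ}

/-- **Gronwall for `|f|`**: if `|f' x| ≤ α + β |f x|` on `[a, b)` (`α, β ≥ 0`), then
`|f x| ≤ (|f a| + α (x - a)) e^{β (x - a)}` on `[a, b]`. [folklore] -/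
theorem abs_le_of_abs_deriv_right_le_affine {α β : ℝ} (hf : ContinuousOn f (Icc a b))
    (hf' : ∀ x ∈ Ico a b, HasDerivWithinAt f (f' x) (Ici x) x) (hα : 0 ≤ α) (hβ : 0 ≤ β)
    (bound : ∀ x ∈ Ico a b, |f' x| ≤ α + β * |f x|) :
    ∀ x ∈ Icc a b, |f x| ≤ (|f a| + α * (x - a)) * exp (β * (x - a)) := by
  intro x hx
  have h := norm_le_gronwallBound_of_norm_deriv_right_le (δ := |f a|) (K := β) (ε := α) hf hf'
    (by simp) (fun y hy => by simpa [Real.norm_eq_abs, add_comm, mul_comm] using bound y hy) x hx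
  rw [Real.norm_eq_abs] at h
  exact h.trans (gronwallBound_le_mul_exp hα hβ)

/-- **Signed linear comparison, upper**: if `f' x ≤ β f x + α` on `[a, b)` then
`f x ≤ gronwallBound (f a) β α (x - a)` on `[a, b]` (any signs). [folklore] -/
theorem le_gronwallBound_of_deriv_right_le {α β : ℝ} (hf : ContinuousOn f (Icc a b))
    (hf' : ∀ x ∈ Ico a b, HasDerivWithinAt f (f' x) (Ici x) x)
    (bound : ∀ x ∈ Ico a b, f' x ≤ β * f x + α) :
    ∀ x ∈ Icc a b, f x ≤ gronwallBound (f a) β α (x - a) := by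
  refine le_gronwallBound_of_liminf_deriv_right_le hf (fun x hx r hr => ?_) le_rfl bound
  have h := (hf' x hx).liminf_right_slope_le hr
  refine h.mono fun z hz => ?_
  simpa [slope_def_field, div_eq_inv_mul] using hz

/-- **Signed linear comparison, lower**: if `β f x - α ≤ f' x` on `[a, b)` then
`-gronwallBound (-f a) β α (x - a) ≤ f x` on `[a, b]` (any signs). [folklore] -/
theorem gronwallBound_neg_le_of_le_deriv_right {α β : ℝ} (hf : ContinuousOn f (Icc a b))
    (hf' : ∀ x ∈ Ico a b, HasDerivWithinAt f (f' x) (Ici x) x)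
    (bound : ∀ x ∈ Ico a b, β * f x - α ≤ f' x) :
    ∀ x ∈ Icc a b, -gronwallBound (-f a) β α (x - a) ≤ f x := by
  intro x hx
  have h := le_gronwallBound_of_deriv_right_le (f := fun y => -f y) (f' := fun y => -f' y)
    (α := α) (β := β) hf.neg (fun y hy => (hf' y hy).neg)
    (fun y hy => by have := bound y hy; linarith) x hx
  linarith

/-! ## One-sided mean value inequalities -/

/-- If `f' ≤ M` on `[a, b)` then `f x - f a ≤ M (x - a)` on `[a, b]`. [folklore] -/
theorem sub_le_mul_of_deriv_right_le {M : ℝ} (hf : ContinuousOn f (Icc a b))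
    (hf' : ∀ x ∈ Ico a b, HasDerivWithinAt f (f' x) (Ici x) x)
    (bound : ∀ x ∈ Ico a b, f' x ≤ M) : ∀ x ∈ Icc a b, f x - f a ≤ M * (x - a) := by
  intro x hx
  have hB : ∀ y, HasDerivAt (fun y => f a + M * (y - a)) M y := by
    intro y
    simpa using ((hasDerivAt_id y).sub_const a).const_mul M |>.const_add (f a)
  have h := image_le_of_deriv_right_le_deriv_boundary hf hf' (B := fun y => f a + M * (y - a))
    (B' := fun _ => M) (by simp) (fun y _ => (hB y).continuousAt.continuousWithinAt)
    (fun y _ => (hB y).hasDerivWithinAt) bound hx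
  linarith

/-- If `M ≤ f'` on `[a, b)` then `M (x - a) ≤ f x - f a` on `[a, b]`. [folklore] -/
theorem mul_le_sub_of_le_deriv_right {M : ℝ} (hf : ContinuousOn f (Icc a b))
    (hf' : ∀ x ∈ Ico a b, HasDerivWithinAt f (f' x) (Ici x) x)
    (bound : ∀ x ∈ Ico a b, M ≤ f' x) : ∀ x ∈ Icc a b, M * (x - a) ≤ f x - f a := by
  intro x hx
  have h := sub_le_mul_of_deriv_right_le (f := fun y => -f y) (f' := fun y => -f' y) (M := -M)
    hf.neg (fun y hy => (hf' y hy).neg) (fun y hy => by have := bound y hy; linarith)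
    x hx
  linarith

/-- If `0 ≤ f'` on `[a, b)` then `f a ≤ f x` on `[a, b]`. [folklore] -/
theorem le_of_deriv_right_nonneg (hf : ContinuousOn f (Icc a b))
    (hf' : ∀ x ∈ Ico a b, HasDerivWithinAt f (f' x) (Ici x) x)
    (bound : ∀ x ∈ Ico a b, 0 ≤ f' x) : ∀ x ∈ Icc a b, f a ≤ f x := by
  intro x hx
  have := mul_le_sub_of_le_deriv_right (M := 0) hf hf' bound x hx
  linarith

/-- If `f' ≤ 0` on `[a, b)` then `f x ≤ f a` on `[a, b]`. [folklore] -/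
theorem le_of_deriv_right_nonpos (hf : ContinuousOn f (Icc a b))
    (hf' : ∀ x ∈ Ico a b, HasDerivWithinAt f (f' x) (Ici x) x)
    (bound : ∀ x ∈ Ico a b, f' x ≤ 0) : ∀ x ∈ Icc a b, f x ≤ f a := by
  intro x hx
  have := sub_le_mul_of_deriv_right_le (M := 0) hf hf' bound x hx
  linarith

/-- Two-sided mean value inequality: `|f'| ≤ M` on `[a, b)` gives `|f x - f a| ≤ M (x - a)`.
[folklore] -/
theorem abs_sub_le_mul_of_abs_deriv_right_le {M : ℝ} (hf : ContinuousOn f (Icc a b))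
    (hf' : ∀ x ∈ Ico a b, HasDerivWithinAt f (f' x) (Ici x) x)
    (bound : ∀ x ∈ Ico a b, |f' x| ≤ M) : ∀ x ∈ Icc a b, |f x - f a| ≤ M * (x - a) := by
  intro x hx
  have h := norm_image_sub_le_of_norm_deriv_right_le_segment hf hf'
    (fun y hy => by simpa [Real.norm_eq_abs] using bound y hy) x hx
  simpa [Real.norm_eq_abs] using h

/-! ## Exponential barriers -/

/-- **Exponential lower barrier**: if `β f x ≤ f' x` on `[a, b)`, then
`f a e^{β (x - a)} ≤ f x` on `[a, b]` (any sign of `f a`). [folklore] -/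
theorem exp_mul_le_of_le_deriv_right {β : ℝ} (hf : ContinuousOn f (Icc a b))
    (hf' : ∀ x ∈ Ico a b, HasDerivWithinAt f (f' x) (Ici x) x)
    (bound : ∀ x ∈ Ico a b, β * f x ≤ f' x) :
    ∀ x ∈ Icc a b, f a * exp (β * (x - a)) ≤ f x := by
  intro x hx
  have h := gronwallBound_neg_le_of_le_deriv_right (α := 0) (β := β) hf hf'
    (fun y hy => by simpa using bound y hy) x hx
  rw [gronwallBound_ε0] at h
  simpa [mul_comm] using h

/-- **Exponential upper barrier**: if `f' x ≤ β f x` on `[a, b)`, then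
`f x ≤ f a e^{β (x - a)}` on `[a, b]`. [folklore] -/
theorem le_mul_exp_of_deriv_right_le {β : ℝ} (hf : ContinuousOn f (Icc a b))
    (hf' : ∀ x ∈ Ico a b, HasDerivWithinAt f (f' x) (Ici x) x)
    (bound : ∀ x ∈ Ico a b, f' x ≤ β * f x) :
    ∀ x ∈ Icc a b, f x ≤ f a * exp (β * (x - a)) := by
  intro x hx
  have h := le_gronwallBound_of_deriv_right_le (α := 0) (β := β) hf hf'
    (fun y hy => by simpa using bound y hy) x hx
  rwa [gronwallBound_ε0] at h

/-! ## Square roots of energies -/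

/-- Derivative of `√(Z + κ)` for `κ > 0` and `Z x ≥ 0`. [folklore] -/
theorem hasDerivWithinAt_sqrt_add_const {Z : ℝ → ℝ} {Z' x κ : ℝ} {s : Set ℝ}
    (hZ : HasDerivWithinAt Z Z' s x) (hκ : 0 < κ) (hx : 0 ≤ Z x) :
    HasDerivWithinAt (fun t => Real.sqrt (Z t + κ)) (Z' / (2 * Real.sqrt (Z x + κ))) s x := by
  have h := (hZ.add_const κ).sqrt (by positivity)
  simpa using h

/-- `|Z'| / (2 √(Z + κ)) ≤ M` whenever `|Z'| ≤ 2 M √Z`, `Z ≥ 0`, `κ > 0`: the standard way to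
turn an energy inequality `|∂ₜ Z| ≤ 2 M Z^{1/2}` into `|∂ₜ √(Z+κ)| ≤ M`. [folklore] -/
theorem abs_div_two_sqrt_le {Z' Zx κ M : ℝ} (hκ : 0 < κ) (hZ : 0 ≤ Zx) (hM : 0 ≤ M)
    (h : |Z'| ≤ 2 * M * Real.sqrt Zx) : |Z' / (2 * Real.sqrt (Zx + κ))| ≤ M := by
  have hs : Real.sqrt Zx ≤ Real.sqrt (Zx + κ) := Real.sqrt_le_sqrt (by linarith)
  have hpos : 0 < Real.sqrt (Zx + κ) := Real.sqrt_pos.2 (by linarith)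
  rw [abs_div, abs_of_pos (by positivity : (0 : ℝ) < 2 * Real.sqrt (Zx + κ)),
    div_le_iff₀ (by positivity)]
  nlinarith

/-! ## First exit times for a closed scalar condition

(A time `t ∈ [a, b]` up to which the condition holds is at most the maximal time: use
`le_maximalTimeP` of `MaximalTime.lean` directly, `le_maximalTimeP (P := fun s => g s ≤ C) ht h`.) -/

section MaxTime

variable {g : ℝ → ℝ} {a b C : ℝ}

/-- For `g` continuous on `[a, b]`, the condition `g t ≤ C` passes to limits from the left.
[folklore] -/
theorem le_const_of_forall_Ico (hg : ContinuousOn g (Icc a b)) {t : ℝ} (ht : t ∈ Ioc a b)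
    (h : ∀ s ∈ Ico a t, g s ≤ C) : g t ≤ C := by
  have htc : t ∈ closure (Ico a t) := by
    rw [closure_Ico ht.1.ne]; exact right_mem_Icc.2 ht.1.le
  have hsub : Ico a t ⊆ Icc a b := fun s hs => ⟨hs.1, hs.2.le.trans ht.2⟩
  have hcont : ContinuousWithinAt g (Ico a t) t :=
    (hg t ⟨ht.1.le, ht.2⟩).mono hsub
  exact hcont.closure_le htc continuousWithinAt_const h

/-- The maximal time `t* = maximalTimeP (g · ≤ C) a b` of a closed scalar condition with `g a ≤ C`:
the condition holds on all of `[a, t*]`. [folklore] -/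
theorem maximalTimeP_le_const_spec (hab : a ≤ b) (hg : ContinuousOn g (Icc a b)) (ha : g a ≤ C)
    {t : ℝ} (ht : t ∈ Icc a (maximalTimeP (fun s => g s ≤ C) a b)) : g t ≤ C :=
  maximalTimeP_spec (P := fun s => g s ≤ C) hab ha
    (fun _ ht h => le_const_of_forall_Ico hg ht h) ht

/-- **Exit value.** If the maximal time `t*` of the condition `g ≤ C` is `< b`, then `g t* = C`.
[folklore] -/
theorem eq_of_maximalTimeP_le_const_lt (hab : a ≤ b) (hg : ContinuousOn g (Icc a b))
    (ha : g a ≤ C) (hlt : maximalTimeP (fun s => g s ≤ C) a b < b) :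
    g (maximalTimeP (fun s => g s ≤ C) a b) = C := by
  set T := maximalTimeP (fun s => g s ≤ C) a b with hT
  have hTmem : T ∈ Icc a b := maximalTimeP_mem hab ha
  have hle : g T ≤ C := maximalTimeP_le_const_spec hab hg ha ⟨hTmem.1, le_rfl⟩
  refine le_antisymm hle ?_
  by_contra hcon
  push Not at hcon
  have hev : ∀ᶠ t in 𝓝[Icc a b] T, g t ≤ C :=
    ((hg T hTmem).eventually_lt_const hcon).mono fun _ h => h.le
  exact not_eventually_of_maximalTimeP_lt hab ha hlt hev

/-- The maximal time lies in `[a, b]`. [folklore] -/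
theorem maximalTimeP_le_const_mem (hab : a ≤ b) (ha : g a ≤ C) :
    maximalTimeP (fun s => g s ≤ C) a b ∈ Icc a b :=
  maximalTimeP_mem (P := fun s => g s ≤ C) hab ha

end MaxTime

end Literature.Analysis.ODE
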